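import Summits.FinalStateConjecture.FinalStateConjecture.Theorems.ZeroEnergyKerrOrBombStationaryLimitReductionRecutCoveringJunctionCore
import Literature.Geometry.Lorentzian.BackgroundChartCalculus
import Literature.Geometry.Lorentzian.ConvergenceTransport
import Literature.Geometry.Lorentzian.HypersurfaceRestriction
import Mathlib.Geometry.Manifold.LocalDiffeomorph
import Mathlib.Analysis.Calculus.Deriv.MeanValue
import HarnessLib

/-!
# Route ZeroEnergyKerrOrBomb · crux `FinalStateFromKerrOrBomb` (stmt-FinalStateConjecture-17839), line
# `SketchIdeator1` — stub `stub_recutJunctionCoreOriented`, ingredient (a): chart time is a time function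

Helper file (`--supports stmt-FinalStateConjecture-17839`; registered helper `junctionTimeFunction_flat`) of the
lead's wave-2 stub worker (2026-08-17). Ingredient (a) of the oriented junction core (`RecutJunctionCore` with the
orientation clauses): on a region `S` of the domain of a smooth chart map `ψ : B.domain → 𝒟` where the pulled-back
metric is `C⁰`-close to the background, `‖(ψ^* g − g₀)(x)‖ ≤ ε`, and the push-forward of the background time field
`V = −g₀♯(dt)` is future-directed, the chart time `t ∘ ψ⁻¹` is STRICTLY INCREASING along every future causal curve
of `𝒟` running in `ψ(S)`. Mechanism (§1, §3): `γ' = dψ(β')` for the lift `β`; `(ψ^* g)(β', β') ≤ 0` and — timecone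
lemma applied to the future timelike `dψ(V)` — `(ψ^* g)(V, β') < 0`; the background cone estimate
`g₀(w, w) ≤ ε‖w‖² ⟹ κ‖w‖ ≤ |dt(w)|` and `g₀(V, w) = −dt(w)` then force `dt(β') ≥ κ‖β'‖ > 0` once `ε‖V‖ < κ`
(`le_apply_of_norm_sub_le`, `strictMonoOn_time_lift`). The lift is differentiable because a chart with nondegenerate
pulled-back metric is a local diffeomorphism (§2–§3, inverse function theorem, `BackgroundChartCalculus`), and exists
and is continuous through a late chart (§4, open embedding of the late region). §5 specialises to flat charts
(`η(∂₀, ·) = −dx⁰`, pinching `1/100`): `flat_strictMonoOn_time_lift`, `flat_time_le_of_isLateChart`; the boosted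
Kerr–Schild specialisation (`g_{M,a}(V, ·) = −dt*`, `g_{M,a}(V, V) = −1 − 2H`) is the companion file
`…JunctionTimeFunctionKerr.lean`. Elementary; no named fact, nothing restated.

References: Dafermos–Rodnianski arXiv:0811.0354, §5.1 (`t*` is a time function: `g(∇t*, ∇t*) = −1 − 2H`);
O'Neill 1983, Ch. 3, pp. 90–91 (local diffeomorphisms), Ch. 5, Lemma 5.29, p. 145 (timecones), Ch. 14, p. 402.
-/

set_option linter.dupNamespace false

noncomputable section

open scoped Manifold ContDiff Topology ENNReal
open Set Filter Function Topology Literature.Geometry.Lorentzian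

namespace Summit.FinalStateConjecture.FinalStateConjecture.Theorems.SymplecticDualOfTheBomb

open Summit.FinalStateConjecture.FinalStateConjecture.Theorems.OneLockedExplosion

/-! ## §1 Pointwise linear algebra -/

section Pointwise

/-- `|G(v, w) − g₀(v, w)| ≤ ε ‖v‖ ‖w‖` when `‖G − g₀‖ ≤ ε`. [folklore] -/
theorem abs_sub_apply_le {g₀ G : E4 →L[ℝ] E4 →L[ℝ] ℝ} {ε : ℝ} (hG : ‖G - g₀‖ ≤ ε) (v w : E4) :
    |G v w - g₀ v w| ≤ ε * ‖v‖ * ‖w‖ := by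
  have h1 : |(G - g₀) v w| ≤ ‖G - g₀‖ * ‖v‖ * ‖w‖ := by
    rw [← Real.norm_eq_abs]; exact (G - g₀).le_opNorm₂ v w
  simp only [sub_apply] at h1
  exact h1.trans (mul_le_mul_of_nonneg_right (mul_le_mul_of_nonneg_right hG (norm_nonneg _)) (norm_nonneg _))

/-- **Pointwise sign lemma.** Let `‖G − g₀‖ ≤ ε`, `g₀(V, ·) = −L`, `‖V‖ ≤ C`, and suppose the cone estimate
`g₀(w, w) ≤ ε‖w‖² ⟹ κ‖w‖ ≤ |L w|` with `ε C < κ`. Then every `G`-causal `w` in the `G`-cone of `V`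
(`G(w, w) ≤ 0`, `G(V, w) < 0`) has `κ ‖w‖ ≤ L w`. [folklore] -/
theorem le_apply_of_norm_sub_le {g₀ G : E4 →L[ℝ] E4 →L[ℝ] ℝ} {L : E4 →L[ℝ] ℝ} {V w : E4} {ε C κ : ℝ}
    (hG : ‖G - g₀‖ ≤ ε) (hV : ∀ w' : E4, g₀ V w' = -L w') (hC : ‖V‖ ≤ C)
    (hcs : ∀ w' : E4, g₀ w' w' ≤ ε * ‖w'‖ ^ 2 → κ * ‖w'‖ ≤ |L w'|) (hεC : ε * C < κ) (hε : 0 ≤ ε)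
    (hww : G w w ≤ 0) (hVw : G V w < 0) : κ * ‖w‖ ≤ L w := by
  have h1 := abs_sub_apply_le hG w w
  have h2 := abs_sub_apply_le hG V w
  have hw0 : w ≠ 0 := by rintro rfl; simp at hVw
  have hwpos : 0 < ‖w‖ := norm_pos_iff.2 hw0
  have h3 : g₀ w w ≤ ε * ‖w‖ ^ 2 := by rw [pow_two, ← mul_assoc]; linarith [(abs_le.1 h1).1]
  have h4 := hcs w h3
  have h5 : -L w < ε * C * ‖w‖ := by
    have h6 := (abs_le.1 h2).1
    rw [hV w] at h6
    have h7 : ε * ‖V‖ * ‖w‖ ≤ ε * C * ‖w‖ :=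
      mul_le_mul_of_nonneg_right (mul_le_mul_of_nonneg_left hC hε) hwpos.le
    linarith
  rcases le_or_gt 0 (L w) with hL | hL
  · rwa [abs_of_nonneg hL] at h4
  · rw [abs_of_neg hL] at h4
    have h9 := lt_of_mul_lt_mul_right (h4.trans_lt h5) hwpos.le
    linarith

/-- Nondegeneracy from the same data: under the hypotheses of `le_apply_of_norm_sub_le` a symmetric `G` is
nondegenerate. [folklore] -/
theorem nondegenerate_of_norm_sub_le {g₀ G : E4 →L[ℝ] E4 →L[ℝ] ℝ} {L : E4 →L[ℝ] ℝ} {V : E4} {ε C κ : ℝ}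
    (hG : ‖G - g₀‖ ≤ ε) (hV : ∀ w' : E4, g₀ V w' = -L w') (hC : ‖V‖ ≤ C)
    (hcs : ∀ w' : E4, g₀ w' w' ≤ ε * ‖w'‖ ^ 2 → κ * ‖w'‖ ≤ |L w'|) (hεC : ε * C < κ) (hε : 0 ≤ ε)
    (hsymm : ∀ v w : E4, G v w = G w v) (v : E4) (hv : ∀ w : E4, G v w = 0) : v = 0 := by
  by_contra hv0
  have hvpos : 0 < ‖v‖ := norm_pos_iff.2 hv0
  have h1 := abs_sub_apply_le hG v v
  have h2 := abs_sub_apply_le hG V v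
  rw [hv v, zero_sub, abs_neg] at h1
  rw [← hsymm, hv V, zero_sub, abs_neg, hV v, abs_neg] at h2
  have h3 : g₀ v v ≤ ε * ‖v‖ ^ 2 := by rw [pow_two, ← mul_assoc]; linarith [le_abs_self (g₀ v v)]
  have h8 : κ * ‖v‖ ≤ ε * C * ‖v‖ :=
    (hcs v h3).trans (h2.trans (mul_le_mul_of_nonneg_right (mul_le_mul_of_nonneg_left hC hε) hvpos.le))
  have h9 := le_of_mul_le_mul_right h8 hvpos
  linarith

/-- `η(u, u) = ‖u‖² − 2 (u⁰)²` for the Euclidean norm of `E4`. [folklore] -/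
theorem minkowski_bilin_self_eq (u : E4) : Minkowski.bilin u u = ‖u‖ ^ 2 - 2 * u 0 ^ 2 := by
  simp only [Minkowski.bilin_apply, EuclideanSpace.real_norm_sq_eq, Fin.sum_univ_four, Fin.sum_univ_three]
  simp only [pow_two, Fin.succ_zero_eq_one, Fin.succ_one_eq_two, show (2 : Fin 3).succ = (3 : Fin 4) from rfl]
  ring

/-- **The flat cone estimate**: `η(u, u) ≤ ‖u‖²/2` forces `‖u‖/2 ≤ |u⁰|`. [folklore] -/
theorem half_norm_le_abs_apply_zero {u : E4} (hu : Minkowski.bilin u u ≤ 1 / 2 * ‖u‖ ^ 2) :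
    ‖u‖ / 2 ≤ |u 0| := by
  rw [minkowski_bilin_self_eq] at hu
  have h1 : (‖u‖ / 2) ^ 2 ≤ (u 0) ^ 2 := by nlinarith
  simpa [abs_of_nonneg (by positivity : (0 : ℝ) ≤ ‖u‖ / 2)] using sq_le_sq.1 h1

end Pointwise

/-! ## §2 Lifting a curve through a chart which is a local diffeomorphism along it -/

section Lift

variable {EM : Type*} [NormedAddCommGroup EM] [NormedSpace ℝ EM] {HM : Type*} [TopologicalSpace HM]
  {IM : ModelWithCorners ℝ EM HM} {M : Type*} [TopologicalSpace M] [ChartedSpace HM M]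
  {EN : Type*} [NormedAddCommGroup EN] [NormedSpace ℝ EN] {HN : Type*} [TopologicalSpace HN]
  {IN : ModelWithCorners ℝ EN HN} {N : Type*} [TopologicalSpace N] [ChartedSpace HN N]

/-- **A continuous lift `β` of a differentiable curve `γ` through a local diffeomorphism `ψ` at `β t` is
differentiable at `t`, with `dψ(β' t) = γ' t`** (near `t`, `β = ψ⁻¹_loc ∘ γ`). O'Neill 1983, Ch. 3, pp. 90–91. [folklore] -/
theorem mdifferentiableAt_lift_of_isLocalDiffeomorphAt {ψ : M → N} {β : ℝ → M} {γ : ℝ → N} {t : ℝ}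
    (hψ : IsLocalDiffeomorphAt IM IN ∞ ψ (β t)) (hβ : ContinuousAt β t) (hβγ : (ψ ∘ β) =ᶠ[𝓝 t] γ)
    (hγ : MDifferentiableAt 𝓘(ℝ, ℝ) IN γ t) :
    MDifferentiableAt 𝓘(ℝ, ℝ) IM β t ∧
      mfderiv IM IN ψ (β t) (velocity IM β t) = velocity IN γ t := by
  have h1 : ∀ᶠ y in 𝓝 (β t), hψ.localInverse (ψ y) = y := hψ.localInverse_eventuallyEq_left
  have h3 : β =ᶠ[𝓝 t] (hψ.localInverse ∘ γ) := by
    filter_upwards [hβ.eventually h1, hβγ] with s hs hs'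
    show β s = hψ.localInverse (γ s)
    rw [← hs', Function.comp_apply, hs]
  have hγt : ψ (β t) = γ t := hβγ.self_of_nhds
  have hli : MDifferentiableAt IN IM hψ.localInverse (γ t) := by
    rw [← hγt]; exact hψ.localInverse_mdifferentiableAt (by simp)
  have hβd : MDifferentiableAt 𝓘(ℝ, ℝ) IM β t := h3.mdifferentiableAt_iff.2 (hli.comp t hγ)
  refine ⟨hβd, ?_⟩
  have h4 : mfderiv 𝓘(ℝ, ℝ) IN γ t = (mfderiv IM IN ψ (β t)).comp (mfderiv 𝓘(ℝ, ℝ) IM β t) := by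
    rw [← hβγ.mfderiv_eq]
    exact mfderiv_comp t (hψ.mdifferentiableAt (by simp)) hβd
  change mfderiv IM IN ψ (β t) (mfderiv 𝓘(ℝ, ℝ) IM β t 1) = mfderiv 𝓘(ℝ, ℝ) IN γ t 1
  rw [h4]; rfl

end Lift

/-! ## §3 The engine: chart time along lifts of future causal curves -/

section Engine

variable (𝓢 : Spacetime.{0} 4) (B : ModelBackground)

/-- **A smooth chart map with nondegenerate pulled-back metric at `x` is a local diffeomorphism at `x`** (inverse
function theorem through the parametrisation `ψ ∘ (chartAt E4 x).symm`). O'Neill 1983, Ch. 3, p. 90. [folklore] -/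
theorem isLocalDiffeomorphAt_of_pullback_nondegenerate (ψ : B.domain → 𝓢.carrier)
    (hψ : ContMDiff 𝓘(ℝ, E4) (𝓡 4) ∞ ψ) (x : B.domain)
    (hnd : ∀ v : E4, (∀ w : E4, (𝓢.deviation B ψ x + B.bilin x.1) v w = 0) → v = 0) :
    IsLocalDiffeomorphAt 𝓘(ℝ, E4) (𝓡 4) ∞ ψ x := by
  have hψ' : ContMDiffOn 𝓘(ℝ, E4) (𝓡 4) ∞ (ψ ∘ (chartAt E4 x).symm) B.domain :=
    𝓢.contMDiffOn_comp_chartAt_symm B ψ x hψ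
  have hx : (x : E4) ∈ (B.domain : Set E4) := x.2
  have heq : 𝓢.metricInCoords (ψ ∘ (chartAt E4 x).symm) x = 𝓢.deviation B ψ x + B.bilin x.1 :=
    𝓢.metricInCoords_comp_chartAt_symm_eq_deviation_add B ψ x hx ((hψ ⟨x, hx⟩).mdifferentiableAt (by simp))
  have h1 : IsLocalDiffeomorphAt 𝓘(ℝ, E4) (𝓡 4) ∞ (ψ ∘ (chartAt E4 x).symm) (x : E4) :=
    𝓢.isLocalDiffeomorphAt_of_metricInCoords_nondegenerate B.domain.2 hψ' hx (by rw [heq]; exact hnd)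
  have h2 : IsLocalDiffeomorphAt 𝓘(ℝ, E4) (𝓡 4) ∞
      ((ψ ∘ (chartAt E4 x).symm) ∘ (Subtype.val : B.domain → E4)) x :=
    IsLocalDiffeomorphAt.comp (hf := isLocalDiffeomorph_subtypeVal (I := 𝓘(ℝ, E4)) B.domain x) (hg := h1)
  rwa [Spacetime.comp_chartAt_symm_comp_subtypeVal] at h2

-- `TangentSpace 𝓘(ℝ, ℝ) t` is definitionally `ℝ`; reading the manifold derivative of the real function `t ∘ β` as an
-- ordinary derivative moves across this identification (same pattern as the tree's `KerrTime.hasDerivAt_time_comp`).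
set_option backward.isDefEq.respectTransparency false in
/-- Chain rule for the chart time along a differentiable curve `β` in the background domain:
`(t ∘ β)' = dt(β')`. [folklore] -/
theorem hasDerivAt_time_comp {β : ℝ → B.domain} {t : ℝ} {L : E4 →L[ℝ] ℝ}
    (hL : HasFDerivAt B.time L (β t).1) (hβ : MDifferentiableAt 𝓘(ℝ, ℝ) 𝓘(ℝ, E4) β t) :
    HasDerivAt (fun s ↦ B.time (β s).1) (L (show E4 from velocity 𝓘(ℝ, E4) β t)) t := by
  have hφ : HasMFDerivAt 𝓘(ℝ, E4) 𝓘(ℝ, ℝ) (fun y : B.domain ↦ B.time y.1) (β t)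
      (L.comp (ContinuousLinearMap.id ℝ E4)) :=
    (hasMFDerivAt_iff_hasFDerivAt.2 hL).comp (β t) (hasMFDerivAt_subtypeVal (I' := 𝓘(ℝ, E4)) (β t))
  rw [hasDerivAt_iff_hasFDerivAt, ← hasMFDerivAt_iff_hasFDerivAt]
  apply (hφ.comp t hβ.hasMFDerivAt).congr_mfderiv
  rw [ContinuousLinearMap.ext_iff]
  intro (r : ℝ)
  have hr : (mfderiv 𝓘(ℝ, ℝ) 𝓘(ℝ, E4) β t) r = r • (mfderiv 𝓘(ℝ, ℝ) 𝓘(ℝ, E4) β t) (1 : ℝ) := by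
    rw [← map_smul]; congr 1; exact (mul_one r).symm
  change L ((mfderiv 𝓘(ℝ, ℝ) 𝓘(ℝ, E4) β t) r) = r • L (show E4 from velocity 𝓘(ℝ, E4) β t)
  rw [hr, map_smul]; rfl

/-- **A pinched chart pushes a background-timelike vector with margin to a timelike vector**:
`g(dψ V, dψ V) ≤ g₀(V, V) + ε ‖V‖² < 0` if `‖(ψ^* g − g₀)(x)‖ ≤ ε`. [folklore] -/
theorem isTimelike_mfderiv_of_norm_deviation_le (ψ : B.domain → 𝓢.carrier) {x : B.domain} {V : E4} {ε : ℝ}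
    (hdev : ‖𝓢.deviation B ψ x‖ ≤ ε) (hV : B.bilin x.1 V V + ε * ‖V‖ ^ 2 < 0) :
    𝓢.metric.IsTimelike (mfderiv 𝓘(ℝ, E4) (𝓡 4) ψ x V) := by
  have hG : ‖𝓢.deviation B ψ x + B.bilin x.1 - B.bilin x.1‖ ≤ ε := by
    rwa [show 𝓢.deviation B ψ x + B.bilin x.1 - B.bilin x.1 = 𝓢.deviation B ψ x by ext v w; simp]
  have h1 := (abs_le.1 (abs_sub_apply_le hG V V)).2
  rw [add_apply, add_apply, Spacetime.deviation_apply, pow_two, ← mul_assoc] at *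
  show 𝓢.metric.val (ψ x) _ _ < 0
  linarith

variable {𝓢 B}

/-- **Engine: chart time is strictly increasing along lifts of future causal curves.** On `S ⊆ B.domain` let the
background time `t` have differential `L`, `g₀(V, ·) = −L`, `‖V‖ ≤ C`, `g₀(V, V) + ε C² < 0`, and the cone estimate
`g₀(w, w) ≤ ε‖w‖² ⟹ κ‖w‖ ≤ |L w|` hold with `ε C < κ`; let `‖(ψ^* g − g₀)(x)‖ ≤ ε` and `dψ(V)` be future-directed on
`S`. Then for every future causal curve `γ` on `[a, b]` and every continuous lift `β` of `γ` through `ψ` in `S`,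
`s ↦ t(β s)` is strictly increasing (derivative `L(β') ≥ κ‖β'‖ > 0`). Dafermos–Rodnianski arXiv:0811.0354, §5.1. [folklore] -/
theorem strictMonoOn_time_lift {ψ : B.domain → 𝓢.carrier} (hψ : ContMDiff 𝓘(ℝ, E4) (𝓡 4) ∞ ψ)
    {S : Set B.domain} {V : B.domain → E4} {L : B.domain → E4 →L[ℝ] ℝ} {ε C κ : ℝ} (hε : 0 ≤ ε)
    (hεC : ε * C < κ) (hL : ∀ x ∈ S, HasFDerivAt B.time (L x) x.1)
    (hV : ∀ x ∈ S, ∀ w : E4, B.bilin x.1 (V x) w = -L x w) (hC : ∀ x ∈ S, ‖V x‖ ≤ C)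
    (hVV : ∀ x ∈ S, B.bilin x.1 (V x) (V x) + ε * C ^ 2 < 0)
    (hcs : ∀ x ∈ S, ∀ w : E4, B.bilin x.1 w w ≤ ε * ‖w‖ ^ 2 → κ * ‖w‖ ≤ |L x w|)
    (hdev : ∀ x ∈ S, ‖𝓢.deviation B ψ x‖ ≤ ε)
    (hfut : ∀ x ∈ S, 𝓢.timeOrientation.IsFutureDirected (mfderiv 𝓘(ℝ, E4) (𝓡 4) ψ x (V x)))
    {γ : ℝ → 𝓢.carrier} {a b : ℝ} (hγ : 𝓢.metric.IsFutureCausalCurveOn 𝓢.timeOrientation γ (Icc a b))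
    {β : ℝ → B.domain} (hβc : ContinuousOn β (Icc a b)) (hβγ : EqOn (ψ ∘ β) γ (Icc a b))
    (hβS : MapsTo β (Icc a b) S) :
    StrictMonoOn (fun s ↦ B.time (β s).1) (Icc a b) := by
  -- the pulled-back metric at a point, as a bilinear form on `E4`
  have hGdef : ∀ x : B.domain, ∀ v w : E4, (𝓢.deviation B ψ x + B.bilin x.1) v w =
      𝓢.metric.val (ψ x) (mfderiv 𝓘(ℝ, E4) (𝓡 4) ψ x v) (mfderiv 𝓘(ℝ, E4) (𝓡 4) ψ x w) := by
    intro x v w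
    rw [add_apply, add_apply, Spacetime.deviation_apply]
    ring
  have hcont : ContinuousOn (fun s ↦ B.time (β s).1) (Icc a b) := fun s hs ↦
    ((hL _ (hβS hs)).continuousAt.comp continuous_subtype_val.continuousAt).comp_continuousWithinAt (hβc s hs)
  refine strictMonoOn_of_deriv_pos (convex_Icc a b) hcont fun t ht ↦ ?_
  rw [interior_Icc] at ht
  have htI : t ∈ Icc a b := Ioo_subset_Icc_self ht
  set x : B.domain := β t with hxdef
  have hxS : x ∈ S := hβS htI
  have hC0 : 0 ≤ C := (norm_nonneg _).trans (hC x hxS)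
  set G : E4 →L[ℝ] E4 →L[ℝ] ℝ := 𝓢.deviation B ψ x + B.bilin x.1 with hG
  have hGn : ‖G - B.bilin x.1‖ ≤ ε := by
    rw [hG, show 𝓢.deviation B ψ x + B.bilin x.1 - B.bilin x.1 = 𝓢.deviation B ψ x by ext v w; simp]
    exact hdev x hxS
  have hGsymm : ∀ v w : E4, G v w = G w v := fun v w ↦ by
    rw [hG, hGdef, hGdef]; exact 𝓢.metric.symm (ψ x) _ _
  -- `ψ` is a local diffeomorphism at `x`, so the lift is differentiable at `t` with `dψ(β') = γ'`
  have hloc : IsLocalDiffeomorphAt 𝓘(ℝ, E4) (𝓡 4) ∞ ψ x :=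
    isLocalDiffeomorphAt_of_pullback_nondegenerate 𝓢 B ψ hψ x
      (nondegenerate_of_norm_sub_le hGn (hV x hxS) (hC x hxS) (hcs x hxS) hεC hε hGsymm)
  have hβt : ContinuousAt β t := (hβc t htI).continuousAt (Icc_mem_nhds ht.1 ht.2)
  have hβγt : (ψ ∘ β) =ᶠ[𝓝 t] γ := Filter.eventuallyEq_of_mem (Icc_mem_nhds ht.1 ht.2) fun s hs ↦ hβγ hs
  obtain ⟨hβd, hvel⟩ := mdifferentiableAt_lift_of_isLocalDiffeomorphAt hloc hβt hβγt (hγ t htI).1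
  -- the velocity `w = β' t` is `G`-causal and in the `G`-cone of `V x`
  set w : E4 := velocity 𝓘(ℝ, E4) β t with hw
  have hfd : 𝓢.timeOrientation.IsFutureDirected (x := ψ x) (mfderiv 𝓘(ℝ, E4) (𝓡 4) ψ x w) := by
    rw [hvel]
    have hgen : ∀ p, p = γ t → 𝓢.timeOrientation.IsFutureDirected (x := p) (velocity (𝓡 4) γ t) := by
      rintro p rfl; exact (hγ t htI).2
    exact hgen _ (hβγ htI)
  have hww : G w w ≤ 0 := by rw [hG, hGdef]; exact hfd.1.1
  have hVt : 𝓢.metric.IsTimelike (mfderiv 𝓘(ℝ, E4) (𝓡 4) ψ x (V x)) :=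
    isTimelike_mfderiv_of_norm_deviation_le 𝓢 B ψ (hdev x hxS) (by
      have h : ε * ‖V x‖ ^ 2 ≤ ε * C ^ 2 := mul_le_mul_of_nonneg_left (pow_le_pow_left₀ (norm_nonneg _) (hC x hxS) 2) hε
      linarith [hVV x hxS])
  have hVw : G (V x) w < 0 := by
    rw [hG, hGdef]; exact (hfut x hxS).val_lt_zero 𝓢.timeOrientation hVt hfd
  have hkey : κ * ‖w‖ ≤ L x w := le_apply_of_norm_sub_le hGn (hV x hxS) (hC x hxS) (hcs x hxS) hεC hε hww hVw
  have hw0 : w ≠ 0 := by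
    intro h0; apply hfd.1.2; rw [h0]; exact (mfderiv 𝓘(ℝ, E4) (𝓡 4) ψ x).map_zero
  have hκ : 0 < κ := lt_of_le_of_lt (mul_nonneg hε hC0) hεC
  rw [(hasDerivAt_time_comp B (hL x hxS) hβd).deriv]
  exact lt_of_lt_of_le (mul_pos hκ (norm_pos_iff.2 hw0)) hkey

end Engine

/-! ## §4 Lifts through late charts; pointwise deviation bounds from `truncDeviationCk` -/

section LateChart

variable {𝓢 : Spacetime.{0} 4} {B : ModelBackground}

/-- **Continuous lifts through a late chart.** A curve `γ` continuous on a nonempty `s₀` and running in `ψ(S)`,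
`S` in the late region of a late chart `ψ`, lifts to a curve `β` in `S`, continuous on `s₀`, with `ψ ∘ β = γ` on
`s₀`; the lift is unique among late points (`ψ` is an open embedding of the late region). [folklore] -/
theorem exists_lift_of_isLateChart {O : Set 𝓢.carrier} {τ₀ : ℝ} {ψ : B.domain → 𝓢.carrier}
    (hψ : 𝓢.IsLateChart B O τ₀ ψ) {S : Set B.domain} (hS : S ⊆ B.lateRegion τ₀) {γ : ℝ → 𝓢.carrier}
    {s₀ : Set ℝ} (hne : s₀.Nonempty) (hγc : ContinuousOn γ s₀) (hγS : MapsTo γ s₀ (ψ '' S)) :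
    ∃ β : ℝ → B.domain, ContinuousOn β s₀ ∧ EqOn (ψ ∘ β) γ s₀ ∧ MapsTo β s₀ S ∧
      ∀ s ∈ s₀, ∀ x ∈ B.lateRegion τ₀, ψ x = γ s → x = β s := by
  obtain ⟨t₀, ht₀⟩ := hne
  obtain ⟨z₀, hz₀, -⟩ := hγS ht₀
  haveI : Nonempty (B.lateRegion τ₀) := ⟨⟨z₀, hS hz₀⟩⟩
  set e : B.lateRegion τ₀ → 𝓢.carrier := (B.lateRegion τ₀).restrict ψ with he_def
  have he : IsOpenEmbedding e := hψ.isOpenEmbedding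
  set φ := he.toOpenPartialHomeomorph e with hφ
  have hr : MapsTo γ s₀ (range e) := fun s hs ↦ by
    obtain ⟨z, hz, hzs⟩ := hγS hs
    exact ⟨⟨z, hS hz⟩, hzs⟩
  refine ⟨fun s ↦ ((φ.symm (γ s) : B.lateRegion τ₀) : B.domain), ?_, fun s hs ↦ ?_, fun s hs ↦ ?_,
    fun s hs x hx hxs ↦ ?_⟩
  · have hsymm : ContinuousOn φ.symm (range e) := by
      have h := φ.continuousOn_symm
      rwa [hφ, he.toOpenPartialHomeomorph_target] at h
    exact continuous_subtype_val.comp_continuousOn (hsymm.comp hγc hr)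
  · show e (φ.symm (γ s)) = γ s
    rw [hφ]; exact he.toOpenPartialHomeomorph_right_inv e (hr hs)
  · obtain ⟨z, hz, hzs⟩ := hγS hs
    show ((φ.symm (γ s) : B.lateRegion τ₀) : B.domain) ∈ S
    rw [← hzs, show ψ z = e ⟨z, hS hz⟩ from rfl, hφ, he.toOpenPartialHomeomorph_left_inv]
    exact hz
  · show x = ((φ.symm (γ s) : B.lateRegion τ₀) : B.domain)
    rw [← hxs, show ψ x = e ⟨x, hx⟩ from rfl, hφ, he.toOpenPartialHomeomorph_left_inv]

variable (𝓢 B) in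
/-- **`C⁰`-closeness on a truncated slab is pointwise closeness**: if the `Cᵏ` deviation of `ψ^* g` from `g₀` on
`{t = τ, r ≤ R}` is `< ε`, then `‖(ψ^* g − g₀)(x)‖ < ε` at every point of that slab. [folklore] -/
theorem norm_deviation_lt_of_truncDeviationCk_lt (ψ : B.domain → 𝓢.carrier) {k : ℕ} {R τ ε : ℝ} (hε : 0 < ε)
    (h : 𝓢.truncDeviationCk B ψ k R τ < ENNReal.ofReal ε) {x : B.domain} (hx : x ∈ B.truncTimeSlab R τ) :
    ‖𝓢.deviation B ψ x‖ < ε := by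
  have h2 := enorm_iteratedFDeriv_le_supCkENorm (Nat.zero_le k) (mem_image_of_mem Subtype.val hx)
    (𝓢.deviationExtend B ψ)
  rw [← ofReal_norm, norm_iteratedFDeriv_zero, 𝓢.deviationExtend_coe] at h2
  exact (ENNReal.ofReal_lt_ofReal_iff hε).1 (h2.trans_lt h)

end LateChart

/-! ## §5 Flat charts: `x⁰` is a time function on a `1%`-pinched, future-oriented region -/

section Flat

variable {𝓢 : Spacetime.{0} 4} {U : TopologicalSpace.Opens E4}

/-- **On a `1%`-pinched flat chart `dψ(∂₀)` is timelike** (`η(∂₀, ∂₀) = −1`). [folklore] -/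
theorem flat_isTimelike_basisVector_zero {ψ : (Minkowski.backgroundOn U).domain → 𝓢.carrier}
    {x : (Minkowski.backgroundOn U).domain} (hdev : ‖𝓢.deviation (Minkowski.backgroundOn U) ψ x‖ ≤ 1 / 100) :
    𝓢.metric.IsTimelike (mfderiv 𝓘(ℝ, E4) (𝓡 4) ψ x (E4.basisVector 0)) :=
  isTimelike_mfderiv_of_norm_deviation_le 𝓢 (Minkowski.backgroundOn U) ψ hdev (by
    show Minkowski.bilin (E4.basisVector 0) (E4.basisVector 0) + 1 / 100 * ‖(E4.basisVector 0 : E4)‖ ^ 2 < 0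
    rw [Minkowski.bilin_basisVector_zero, show ‖(E4.basisVector 0 : E4)‖ = 1 by simp [E4.basisVector]]; norm_num)

/-- **Flat chart time is a time function along lifts.** For a smooth chart map `ψ` on the flat background over `U`,
a region `S` on which `‖(ψ^* g − η)(x)‖ ≤ 1/100` and `dψ(∂₀)` is future-directed, and a future causal curve `γ` on
`[a, b]` with a continuous lift `β` through `ψ` in `S`: `s ↦ (β s)⁰` is strictly increasing (engine with `V = ∂₀`,
`L = dx⁰`, `ε = 1/100`, `C = 1`, `κ = 1/2`). [folklore] -/
theorem flat_strictMonoOn_time_lift {ψ : (Minkowski.backgroundOn U).domain → 𝓢.carrier}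
    (hψ : ContMDiff 𝓘(ℝ, E4) (𝓡 4) ∞ ψ) {S : Set (Minkowski.backgroundOn U).domain}
    (hdev : ∀ x ∈ S, ‖𝓢.deviation (Minkowski.backgroundOn U) ψ x‖ ≤ 1 / 100)
    (hfut : ∀ x ∈ S, 𝓢.timeOrientation.IsFutureDirected (mfderiv 𝓘(ℝ, E4) (𝓡 4) ψ x (E4.basisVector 0)))
    {γ : ℝ → 𝓢.carrier} {a b : ℝ} (hγ : 𝓢.metric.IsFutureCausalCurveOn 𝓢.timeOrientation γ (Icc a b))
    {β : ℝ → (Minkowski.backgroundOn U).domain} (hβc : ContinuousOn β (Icc a b))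
    (hβγ : EqOn (ψ ∘ β) γ (Icc a b)) (hβS : MapsTo β (Icc a b) S) :
    StrictMonoOn (fun s ↦ (β s : E4) 0) (Icc a b) :=
  strictMonoOn_time_lift (𝓢 := 𝓢) (B := Minkowski.backgroundOn U) hψ (S := S)
    (V := fun _ ↦ E4.basisVector 0) (L := fun _ ↦ (EuclideanSpace.proj (0 : Fin 4) : E4 →L[ℝ] ℝ))
    (ε := 1 / 100) (C := 1) (κ := 1 / 2) (by norm_num) (by norm_num)
    (fun x _ ↦ (EuclideanSpace.proj (0 : Fin 4) : E4 →L[ℝ] ℝ).hasFDerivAt)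
    (fun x _ w ↦ Minkowski.bilin_basisVector_zero_left w)
    (fun x _ ↦ (show ‖(E4.basisVector 0 : E4)‖ = 1 by simp [E4.basisVector]).le)
    (fun x _ ↦ by
      show Minkowski.bilin (E4.basisVector 0) (E4.basisVector 0) + 1 / 100 * 1 ^ 2 < 0
      rw [Minkowski.bilin_basisVector_zero]; norm_num)
    (fun x _ w hw ↦ by
      change Minkowski.bilin w w ≤ 1 / 100 * ‖w‖ ^ 2 at hw
      have h := half_norm_le_abs_apply_zero (u := w) (by nlinarith [norm_nonneg w])
      show 1 / 2 * ‖w‖ ≤ |w 0|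
      linarith)
    hdev hfut hγ hβc hβγ hβS

/-- **Flat chart time is a time function (late-chart form).** For a late flat chart `Ψ₀` (late time `τ₀`), a region
`S` of its late region on which `‖(Ψ₀^* g − η)(x)‖ ≤ 1/100` and `dΨ₀(∂₀)` is future-directed, and a future causal
curve `γ` on `[a, b]` in `Ψ₀(S)`: `Ψ₀ x = γ s`, `Ψ₀ y = γ t`, `s ≤ t`, `x, y` late imply `x⁰ ≤ y⁰` (`<` if `s < t`,
by `flat_strictMonoOn_time_lift`). Dafermos–Rodnianski arXiv:0811.0354, §5.1. [folklore] -/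
theorem flat_time_le_of_isLateChart {O : Set 𝓢.carrier} {τ₀ : ℝ}
    {ψ : (Minkowski.backgroundOn U).domain → 𝓢.carrier} (hψ : 𝓢.IsLateChart (Minkowski.backgroundOn U) O τ₀ ψ)
    {S : Set (Minkowski.backgroundOn U).domain} (hS : S ⊆ (Minkowski.backgroundOn U).lateRegion τ₀)
    (hdev : ∀ x ∈ S, ‖𝓢.deviation (Minkowski.backgroundOn U) ψ x‖ ≤ 1 / 100)
    (hfut : ∀ x ∈ S, 𝓢.timeOrientation.IsFutureDirected (mfderiv 𝓘(ℝ, E4) (𝓡 4) ψ x (E4.basisVector 0)))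
    {γ : ℝ → 𝓢.carrier} {a b : ℝ} (hγ : 𝓢.metric.IsFutureCausalCurveOn 𝓢.timeOrientation γ (Icc a b))
    (hγS : MapsTo γ (Icc a b) (ψ '' S)) {s t : ℝ} (hs : s ∈ Icc a b) (ht : t ∈ Icc a b) (hst : s ≤ t)
    {x y : (Minkowski.backgroundOn U).domain} (hx : x ∈ (Minkowski.backgroundOn U).lateRegion τ₀)
    (hy : y ∈ (Minkowski.backgroundOn U).lateRegion τ₀) (hxs : ψ x = γ s) (hyt : ψ y = γ t) :
    (x : E4) 0 ≤ (y : E4) 0 := by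
  obtain ⟨β, hβc, hβγ, hβS, huniq⟩ := exists_lift_of_isLateChart hψ hS ⟨s, hs⟩
    (fun r hr ↦ (hγ.continuousAt hr).continuousWithinAt) hγS
  rw [huniq s hs x hx hxs, huniq t ht y hy hyt]
  exact (flat_strictMonoOn_time_lift hψ.contMDiff hdev hfut hγ hβc hβγ hβS).monotoneOn hs ht hst

/-- **Registered helper `junctionTimeFunction_flat` (stub `stub_recutJunctionCoreOriented`, ingredient (a), flat
chart)**: one-line form of `flat_time_le_of_isLateChart` — `x⁰ ∘ Ψ₀⁻¹` is nondecreasing along future causal curves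
in the image of a `1%`-pinched, future-oriented region of the late region of a late flat chart. [folklore] -/
theorem junctionTimeFunction_flat : ∀ (𝓢 : Spacetime.{0} 4) (U : TopologicalSpace.Opens E4) (O : Set 𝓢.carrier) (τ₀ : ℝ) (ψ : (Minkowski.backgroundOn U).domain → 𝓢.carrier), 𝓢.IsLateChart (Minkowski.backgroundOn U) O τ₀ ψ → ∀ (S : Set (Minkowski.backgroundOn U).domain), S ⊆ (Minkowski.backgroundOn U).lateRegion τ₀ → (∀ x ∈ S, ‖𝓢.deviation (Minkowski.backgroundOn U) ψ x‖ ≤ 1 / 100) → (∀ x ∈ S, 𝓢.timeOrientation.IsFutureDirected (mfderiv 𝓘(ℝ, E4) (𝓡 4) ψ x (E4.basisVector 0))) → ∀ (γ : ℝ → 𝓢.carrier) (a b : ℝ), 𝓢.metric.IsFutureCausalCurveOn 𝓢.timeOrientation γ (Set.Icc a b) → Set.MapsTo γ (Set.Icc a b) (ψ '' S) → ∀ (s t : ℝ), s ∈ Set.Icc a b → t ∈ Set.Icc a b → s ≤ t → ∀ (x y : (Minkowski.backgroundOn U).domain), x ∈ (Minkowski.backgroundOn U).lateRegion τ₀ →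 y ∈ (Minkowski.backgroundOn U).lateRegion τ₀ → ψ x = γ s → ψ y = γ t → (x : E4) 0 ≤ (y : E4) 0 :=
  fun _ _ _ _ _ hψ _ hS hdev hfut _ _ _ hγ hγS _ _ hs ht hst _ _ hx hy hxs hyt ↦
    flat_time_le_of_isLateChart hψ hS hdev hfut hγ hγS hs ht hst hx hy hxs hyt

end Flat

end Summit.FinalStateConjecture.FinalStateConjecture.Theorems.SymplecticDualOfTheBomb

end
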